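import Summits.ResolutionOfSingularities.ResolutionOfSingularities.Theorems.FrobeniusLadderFInjectiveMacaulayficationFedderAlongCoordinateLineOffOrigin
import Summits.ResolutionOfSingularities.ResolutionOfSingularities.Theorems.FrobeniusLadderFInjectiveMacaulayficationClauseOfPderivNotMem
import Summits.ResolutionOfSingularities.ResolutionOfSingularities.Theorems.FrobeniusLadderFInjectiveMacaulayficationE8OffCentreRegular
import Summits.ResolutionOfSingularities.ResolutionOfSingularities.Theorems.FrobeniusLadderFInjectiveMacaulayficationE7OffCentreRegular
import Mathlib.RingTheory.Derivation.Basic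
import HarnessLib

/-!
# The cusp-degenerate E8-line: the clause OFF THE STRATUM for `g` and for its cone `g₀`, `char k = 3` (crux `FInjectiveMacaulayfication`, hole #3)

Support file for crux stmt-ResolutionOfSingularities-15315 (`FrobeniusLadder.FInjectiveMacaulayfication`), chain w45a, hole #3; calibration
«CUSP-DEGENERATE E8-LINE» (res-L1-w45a-plan-1 R12.2 (i); scoping memo `L/res-L1-w45a-stub-2/SCOPING-fcusp-F3.md` §3; seat res-L1-w45a-stub-2).
Variables `(e, s, w̃, z̃) = (X 0, X 1, X 2, X 3)`, `g = X1³ + (X1−1)(X3² + X0²X2⁵)`, `g₀ = X1³ − X3² − X0²X2⁵` (the `(0,10,6,15)`-initial form),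
stratum `V(X1,X2,X3)`. THE TWO `hoff` INPUTS of `FilteredConeFiModelRel.filteredConeFiModelRel` at `p = 3`: at every maximal ideal of
`k[X]/(g)` (resp. `k[X]/(g₀)`) missing one of `x̄₁, x̄₂, x̄₃` the per-stalk clause holds. JACOBIAN CASE TREE (`ClauseOfPderivNotMem`):
`∂₃g = 2(X1−1)X3` with `X1 − 1 ∈ P` impossible (`g ≡ 1`), `∂₁g = X3² + X0²X2⁵` at `p = 3`; what is left is the LINE `{X0 = X1 = X3 = 0}`
with `X2 ∉ P` (idea-2's `A₂ × line` curve `L`), for both `g` and `g₀`, where FEDDER is run at every closed point at once: the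
`X0²X3²`-extraction of `g²` and of `g₀²` is `2·T⁵`, and `c³ ∣ 2T⁵` forces `T ∣ c`, i.e. `X2 ∈ P` — the OFF-ORIGIN variant
`FedderAlongCoordinateLineOffOrigin` (this seat) of `FedderAlongCoordinateLine.not_mem_span_pow` (which wants `deg u < p`).
[OURS · L1 W4.5a] AI-written; AI review is weaker than expert review. No statement of Hironaka2017 is used; no external fact.
No definitions, no named facts. [folklore; Fedder's criterion as landed in `FedderAtMaximalIdeal`]
-/

set_option linter.dupNamespace false

noncomputable section

open MvPolynomial

namespace Summit.ResolutionOfSingularities.ResolutionOfSingularities.Theorems.FInjectiveMacaulayfication.CuspE8LineOffStratum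

open Summit.ResolutionOfSingularities.ResolutionOfSingularities.Theorems.FInjectiveMacaulayfication
open FedderAlongCoordinateLine FedderAlongCoordinateLineOffOrigin

variable {k : Type} [Field k]

/-- **FEDDER ON THE LINE `{X0 = X1 = X3 = 0}` OFF THE ORIGIN, `char k = 3`** (coordinates of `k[X₀,…,X₃]`, line coordinate `X 2`): if
the `X0²X3²`-extraction of `h²` is `2·X2⁵` (the only monomials of `h²` with `(X0,X1,X3)`-exponents `(2,0,2)` are `2 X0²X2⁵X3²`), then
`(k[X]/(h))_Q` satisfies the per-stalk clause at every maximal `Q` containing `x̄₀, x̄₁, x̄₃` and NOT `x̄₂`. [folklore] -/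
theorem clause_on_line_char3 [CharP k 3] (h : MvPolynomial (Fin 4) k) (hh0 : h ≠ 0)
    (hcoeff : ∀ t : ℕ, MvPolynomial.coeff (Finsupp.single 0 2 + Finsupp.single 3 2 + Finsupp.single 2 t) (h ^ 2) =
      if t = 5 then (2 : k) else 0)
    (Q : Ideal (MvPolynomial (Fin 4) k ⧸ Ideal.span {h})) [Q.IsMaximal]
    (h0 : Ideal.Quotient.mk (Ideal.span {h}) (X 0) ∈ Q) (h1 : Ideal.Quotient.mk (Ideal.span {h}) (X 1) ∈ Q)
    (h3 : Ideal.Quotient.mk (Ideal.span {h}) (X 3) ∈ Q) (h2 : Ideal.Quotient.mk (Ideal.span {h}) (X 2) ∉ Q) :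
    ∀ d : ℕ, ringKrullDim (Localization.AtPrime Q) = d → ∀ s : Fin d → Localization.AtPrime Q,
      (Ideal.span (Set.range s)).radical.IsMaximal →
        RingTheory.Sequence.IsWeaklyRegular (Localization.AtPrime Q) (List.ofFn s) ∧
        ∀ y : Localization.AtPrime Q, (∃ e : ℕ, y ^ 3 ^ e ∈ Ideal.span
          ((fun z : Localization.AtPrime Q => z ^ 3 ^ e) ''
            (Ideal.span (Set.range s) : Set (Localization.AtPrime Q)))) → y ∈ Ideal.span (Set.range s) := by
  classical
  haveI : Fact (Nat.Prime 3) := ⟨Nat.prime_three⟩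
  haveI hPmax : (Q.comap (Ideal.Quotient.mk (Ideal.span {h}))).IsMaximal :=
    Ideal.comap_isMaximal_of_surjective _ Ideal.Quotient.mk_surjective
  have hXP : ∀ j : Fin 4, j ≠ 2 → (X j : MvPolynomial (Fin 4) k) ∈ Q.comap (Ideal.Quotient.mk (Ideal.span {h})) := by
    intro j hj
    rcases (by decide : ∀ j : Fin 4, j ≠ 2 → j = 0 ∨ j = 1 ∨ j = 3) j hj with rfl | rfl | rfl
    · exact Ideal.mem_comap.mpr h0
    · exact Ideal.mem_comap.mpr h1
    · exact Ideal.mem_comap.mpr h3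
  have hX2 : (X 2 : MvPolynomial (Fin 4) k) ∉ Q.comap (Ideal.Quotient.mk (Ideal.span {h})) := fun hx => h2 (Ideal.mem_comap.mp hx)
  obtain ⟨c, hcu, hcT, hP⟩ := exists_gen_not_X_dvd (2 : Fin 4) (Polynomial.aeval (X 2 : MvPolynomial (Fin 4) k)) rfl
    (Q.comap (Ideal.Quotient.mk (Ideal.span {h}))) hXP hX2
  have h2k : (2 : k) ≠ 0 := by
    intro h2
    have := (CharP.cast_eq_zero_iff k 3 2).mp (by exact_mod_cast h2)
    omega
  have hfed := not_mem_span_pow_of_not_X_dvd 3 (by norm_num) (Finsupp.single 0 2 + Finsupp.single 3 2)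
    (by simp) (fun j => by fin_cases j <;> simp) (Polynomial.aeval (X 2 : MvPolynomial (Fin 4) k)) rfl c hcu hcT (h ^ 2) 5 2 h2k
    hcoeff
  exact FedderAtMaximalIdeal.stub_fedderAtMaximalIdeal 3 k 4 4
    (fun j : Fin 4 => if j = 2 then Polynomial.aeval (X 2 : MvPolynomial (Fin 4) k) c else X j) h Q hP hh0 hfed

/-! ## The extraction coefficient `2·X2⁵` for `g²` and `g₀²` -/

/-- `(X3² + X0²X2⁵)²` as a sum of three monomials. [folklore] -/
theorem D_sq_eq :
    ((X 3 ^ 2 + X 0 ^ 2 * X 2 ^ 5) ^ 2 : MvPolynomial (Fin 4) k) =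
      monomial (Finsupp.single 3 4) 1 + monomial (Finsupp.single 0 2 + Finsupp.single 3 2 + Finsupp.single 2 5) 2 +
        monomial (Finsupp.single 0 4 + Finsupp.single 2 10) 1 := by
  have h2 : (monomial (Finsupp.single 0 2 + Finsupp.single 3 2 + Finsupp.single 2 5) (2 : k) : MvPolynomial (Fin 4) k) =
      C 2 * (X 0 ^ 2 * X 3 ^ 2 * X 2 ^ 5) := by
    rw [X_pow_eq_monomial, X_pow_eq_monomial, X_pow_eq_monomial, monomial_mul, monomial_mul, C_mul_monomial]; norm_num
  have h1 : (monomial (Finsupp.single 3 4) (1 : k) : MvPolynomial (Fin 4) k) = X 3 ^ 4 := by rw [X_pow_eq_monomial]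
  have h3 : (monomial (Finsupp.single 0 4 + Finsupp.single 2 10) (1 : k) : MvPolynomial (Fin 4) k) = X 0 ^ 4 * X 2 ^ 10 := by
    rw [X_pow_eq_monomial, X_pow_eq_monomial, monomial_mul, one_mul]
  rw [h1, h2, h3, map_ofNat]
  ring

/-- The `X0²X3²·X2ᵗ`-coefficients of `X1·A + (X3² + X0²X2⁵)²`: `2` at `t = 5`, `0` otherwise. [folklore] -/
theorem coeff_X_mul_add_D_sq (A : MvPolynomial (Fin 4) k) (t : ℕ) :
    MvPolynomial.coeff (Finsupp.single 0 2 + Finsupp.single 3 2 + Finsupp.single 2 t)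
      (X 1 * A + (X 3 ^ 2 + X 0 ^ 2 * X 2 ^ 5) ^ 2) = if t = 5 then (2 : k) else 0 := by
  classical
  have e1 : (Finsupp.single 3 4 : Fin 4 →₀ ℕ) ≠ Finsupp.single 0 2 + Finsupp.single 3 2 + Finsupp.single 2 t := fun h => by
    have := DFunLike.congr_fun h 0; simp at this
  have e3 : (Finsupp.single 0 4 + Finsupp.single 2 10 : Fin 4 →₀ ℕ) ≠ Finsupp.single 0 2 + Finsupp.single 3 2 + Finsupp.single 2 t :=
    fun h => by have := DFunLike.congr_fun h 0; simp at this
  have e2 : (Finsupp.single 0 2 + Finsupp.single 3 2 + Finsupp.single 2 5 : Fin 4 →₀ ℕ) =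
      Finsupp.single 0 2 + Finsupp.single 3 2 + Finsupp.single 2 t ↔ t = 5 := by
    constructor
    · intro h; have := DFunLike.congr_fun h 2; simpa [Finsupp.single_apply] using this.symm
    · rintro rfl; rfl
  have hX : MvPolynomial.coeff (Finsupp.single 0 2 + Finsupp.single 3 2 + Finsupp.single 2 t) (X 1 * A) = 0 := by
    rw [MvPolynomial.coeff_X_mul', if_neg]
    simp [Finsupp.mem_support_iff]
  rw [MvPolynomial.coeff_add, hX, zero_add, D_sq_eq, MvPolynomial.coeff_add, MvPolynomial.coeff_add, MvPolynomial.coeff_monomial,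
    MvPolynomial.coeff_monomial, MvPolynomial.coeff_monomial, if_neg e1, if_neg e3, zero_add, add_zero]
  by_cases ht : t = 5
  · rw [if_pos ht, if_pos (e2.mpr ht)]
  · rw [if_neg ht, if_neg fun h => ht (e2.mp h)]

/-- `g² = X1·(…) + (X3² + X0²X2⁵)²`, so its `X0²X3²`-extraction is `2X2⁵`. [folklore] -/
theorem coeff_g_sq (g : MvPolynomial (Fin 4) k)
    (hg : g = X 1 ^ 3 + (X 1 - 1) * (X 3 ^ 2 + X 0 ^ 2 * X 2 ^ 5)) (t : ℕ) :
    MvPolynomial.coeff (Finsupp.single 0 2 + Finsupp.single 3 2 + Finsupp.single 2 t) (g ^ 2) = if t = 5 then (2 : k) else 0 := by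
  have h : g ^ 2 = X 1 * (X 1 * (X 1 ^ 2 + X 3 ^ 2 + X 0 ^ 2 * X 2 ^ 5) ^ 2 -
      2 * ((X 1 ^ 2 + X 3 ^ 2 + X 0 ^ 2 * X 2 ^ 5) * (X 3 ^ 2 + X 0 ^ 2 * X 2 ^ 5))) + (X 3 ^ 2 + X 0 ^ 2 * X 2 ^ 5) ^ 2 := by
    rw [hg]; ring
  rw [h]
  exact coeff_X_mul_add_D_sq _ t

/-- `g₀² = X1·(…) + (X3² + X0²X2⁵)²`, so its `X0²X3²`-extraction is `2X2⁵`. [folklore] -/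
theorem coeff_g₀_sq (t : ℕ) :
    MvPolynomial.coeff (Finsupp.single 0 2 + Finsupp.single 3 2 + Finsupp.single 2 t)
      ((X 1 ^ 3 - X 3 ^ 2 - X 0 ^ 2 * X 2 ^ 5 : MvPolynomial (Fin 4) k) ^ 2) = if t = 5 then (2 : k) else 0 := by
  have h : ((X 1 ^ 3 - X 3 ^ 2 - X 0 ^ 2 * X 2 ^ 5 : MvPolynomial (Fin 4) k) ^ 2) =
      X 1 * (X 1 ^ 5 - 2 * (X 1 ^ 2 * (X 3 ^ 2 + X 0 ^ 2 * X 2 ^ 5))) + (X 3 ^ 2 + X 0 ^ 2 * X 2 ^ 5) ^ 2 := by ring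
  rw [h]
  exact coeff_X_mul_add_D_sq _ t

/-! ## Partial derivatives -/

/-- `∂₃ g = 2(X1 − 1)X3` and `∂₁ g = 3X1² + (X3² + X0²X2⁵)`. [folklore] -/
theorem pderivs_g (A : Type) [CommRing A] :
    MvPolynomial.pderiv 3 (X 1 ^ 3 + (X 1 - 1) * (X 3 ^ 2 + X 0 ^ 2 * X 2 ^ 5) : MvPolynomial (Fin 4) A) =
        C 2 * ((X 1 - 1) * X 3) ∧
      MvPolynomial.pderiv 1 (X 1 ^ 3 + (X 1 - 1) * (X 3 ^ 2 + X 0 ^ 2 * X 2 ^ 5) : MvPolynomial (Fin 4) A) =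
        C 3 * X 1 ^ 2 + (X 3 ^ 2 + X 0 ^ 2 * X 2 ^ 5) := by
  constructor
  · simp only [map_add, map_sub, Derivation.leibniz, Derivation.map_one_eq_zero, MvPolynomial.pderiv_pow, MvPolynomial.pderiv_X_self,
      MvPolynomial.pderiv_X_of_ne (show (0 : Fin 4) ≠ 3 by decide), MvPolynomial.pderiv_X_of_ne (show (1 : Fin 4) ≠ 3 by decide),
      MvPolynomial.pderiv_X_of_ne (show (2 : Fin 4) ≠ 3 by decide), smul_eq_mul, mul_zero, add_zero, zero_add, mul_one, map_ofNat,
      sub_zero]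
    ring
  · simp only [map_add, map_sub, Derivation.leibniz, Derivation.map_one_eq_zero, MvPolynomial.pderiv_pow, MvPolynomial.pderiv_X_self,
      MvPolynomial.pderiv_X_of_ne (show (0 : Fin 4) ≠ 1 by decide), MvPolynomial.pderiv_X_of_ne (show (2 : Fin 4) ≠ 1 by decide),
      MvPolynomial.pderiv_X_of_ne (show (3 : Fin 4) ≠ 1 by decide), smul_eq_mul, mul_zero, add_zero, zero_add, mul_one, map_ofNat,
      sub_zero]
    ring

/-- `∂₃ g₀ = −2X3` and `∂₀ g₀ = −2X0X2⁵`. [folklore] -/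
theorem pderivs_g₀ (A : Type) [CommRing A] :
    MvPolynomial.pderiv 3 (X 1 ^ 3 - X 3 ^ 2 - X 0 ^ 2 * X 2 ^ 5 : MvPolynomial (Fin 4) A) = C (-2) * X 3 ∧
      MvPolynomial.pderiv 0 (X 1 ^ 3 - X 3 ^ 2 - X 0 ^ 2 * X 2 ^ 5 : MvPolynomial (Fin 4) A) = C (-2) * (X 0 * X 2 ^ 5) := by
  constructor
  · simp only [map_sub, Derivation.leibniz, MvPolynomial.pderiv_pow, MvPolynomial.pderiv_X_self,
      MvPolynomial.pderiv_X_of_ne (show (0 : Fin 4) ≠ 3 by decide), MvPolynomial.pderiv_X_of_ne (show (1 : Fin 4) ≠ 3 by decide),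
      MvPolynomial.pderiv_X_of_ne (show (2 : Fin 4) ≠ 3 by decide), smul_eq_mul, mul_zero, add_zero, mul_one, map_neg,
      map_ofNat, sub_zero, zero_sub]
    ring
  · simp only [map_sub, Derivation.leibniz, MvPolynomial.pderiv_pow, MvPolynomial.pderiv_X_self,
      MvPolynomial.pderiv_X_of_ne (show (1 : Fin 4) ≠ 0 by decide), MvPolynomial.pderiv_X_of_ne (show (2 : Fin 4) ≠ 0 by decide),
      MvPolynomial.pderiv_X_of_ne (show (3 : Fin 4) ≠ 0 by decide), smul_eq_mul, mul_zero, zero_add, mul_one, map_neg,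
      map_ofNat, sub_zero, zero_sub]
    ring

/-! ## The clause off the stratum `V(X1,X2,X3)`, `char k = 3` -/

/-- **hoff for `g`**: at every maximal ideal of `k[e,s,w̃,z̃]/(g)` missing one of `s̄, w̄̃, z̄̃` the per-stalk clause holds
(`char k = 3`). [folklore] -/
theorem cuspE8Line_offStratum_clause [CharP k 3] (g : MvPolynomial (Fin 4) k)
    (hg : g = X 1 ^ 3 + (X 1 - 1) * (X 3 ^ 2 + X 0 ^ 2 * X 2 ^ 5)) :
    ∀ (Q : Ideal (MvPolynomial (Fin 4) k ⧸ Ideal.span {g})) [Q.IsMaximal],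
      (∃ j ∈ ({1, 2, 3} : Finset (Fin 4)), Ideal.Quotient.mk (Ideal.span {g}) (MvPolynomial.X j) ∉ Q) →
      ∀ d : ℕ, ringKrullDim (Localization.AtPrime Q) = d → ∀ s : Fin d → Localization.AtPrime Q,
        (Ideal.span (Set.range s)).radical.IsMaximal →
          RingTheory.Sequence.IsWeaklyRegular (Localization.AtPrime Q) (List.ofFn s) ∧
          ∀ y : Localization.AtPrime Q, (∃ e : ℕ, y ^ 3 ^ e ∈ Ideal.span
            ((fun z : Localization.AtPrime Q => z ^ 3 ^ e) ''
              (Ideal.span (Set.range s) : Set (Localization.AtPrime Q)))) → y ∈ Ideal.span (Set.range s) := by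
  intro Q _ hQ
  haveI : Fact (Nat.Prime 3) := ⟨Nat.prime_three⟩
  haveI hprime : (Q.comap (Ideal.Quotient.mk (Ideal.span {g}))).IsPrime := Ideal.comap_isPrime _ _
  have hmem : ∀ q : MvPolynomial (Fin 4) k, q ∈ Q.comap (Ideal.Quotient.mk (Ideal.span {g})) ↔
      Ideal.Quotient.mk (Ideal.span {g}) q ∈ Q := fun q => Ideal.mem_comap
  have hgP : g ∈ Q.comap (Ideal.Quotient.mk (Ideal.span {g})) := by
    rw [Ideal.mem_comap, Ideal.Quotient.eq_zero_iff_mem.mpr (Ideal.mem_span_singleton_self g)]; exact Q.zero_mem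
  have hg0 : g ≠ 0 := by
    rw [hg]; intro h
    have h1 := congrArg (MvPolynomial.eval (![0, 1, 0, 0] : Fin 4 → k)) h
    simp at h1
  -- not all three stratum variables lie in `P`
  have hnot : ¬ ((X 1 : MvPolynomial (Fin 4) k) ∈ Q.comap (Ideal.Quotient.mk (Ideal.span {g})) ∧
      (X 2 : MvPolynomial (Fin 4) k) ∈ Q.comap (Ideal.Quotient.mk (Ideal.span {g})) ∧
      (X 3 : MvPolynomial (Fin 4) k) ∈ Q.comap (Ideal.Quotient.mk (Ideal.span {g}))) := by
    rintro ⟨h1, h2, h3⟩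
    obtain ⟨j, hj, hjQ⟩ := hQ
    simp only [Finset.mem_insert, Finset.mem_singleton] at hj
    rcases hj with rfl | rfl | rfl
    exacts [hjQ ((hmem _).mp h1), hjQ ((hmem _).mp h2), hjQ ((hmem _).mp h3)]
  obtain ⟨hd3, hd1⟩ := pderivs_g k
  rw [← hg] at hd3 hd1
  -- `X1³ ∈ P` as soon as `D = X3² + X0²X2⁵ ∈ P`
  have hX1_of_D : (X 3 ^ 2 + X 0 ^ 2 * X 2 ^ 5 : MvPolynomial (Fin 4) k) ∈ Q.comap (Ideal.Quotient.mk (Ideal.span {g})) →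
      (X 1 : MvPolynomial (Fin 4) k) ∈ Q.comap (Ideal.Quotient.mk (Ideal.span {g})) := fun hD => by
    refine hprime.mem_of_pow_mem 3 ?_
    have e : (X 1 ^ 3 : MvPolynomial (Fin 4) k) = g - (X 1 - 1) * (X 3 ^ 2 + X 0 ^ 2 * X 2 ^ 5) := by rw [hg]; ring
    rw [e]
    exact Ideal.sub_mem _ hgP (Ideal.mul_mem_left _ _ hD)
  by_cases hX3 : (X 3 : MvPolynomial (Fin 4) k) ∈ Q.comap (Ideal.Quotient.mk (Ideal.span {g}))
  · by_cases hD : (X 3 ^ 2 + X 0 ^ 2 * X 2 ^ 5 : MvPolynomial (Fin 4) k) ∈ Q.comap (Ideal.Quotient.mk (Ideal.span {g}))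
    · have hX1 := hX1_of_D hD
      have h02 : (X 0 ^ 2 * X 2 ^ 5 : MvPolynomial (Fin 4) k) ∈ Q.comap (Ideal.Quotient.mk (Ideal.span {g})) := by
        have e : (X 0 ^ 2 * X 2 ^ 5 : MvPolynomial (Fin 4) k) = (X 3 ^ 2 + X 0 ^ 2 * X 2 ^ 5) - X 3 * X 3 := by ring
        rw [e]; exact Ideal.sub_mem _ hD (Ideal.mul_mem_left _ _ hX3)
      rcases hprime.mem_or_mem h02 with h0 | h2
      · -- the line `X0 = X1 = X3 = 0`, `X2 ∉ P`
        have hX0 := hprime.mem_of_pow_mem 2 h0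
        have hX2 : (X 2 : MvPolynomial (Fin 4) k) ∉ Q.comap (Ideal.Quotient.mk (Ideal.span {g})) := fun h => hnot ⟨hX1, h, hX3⟩
        exact clause_on_line_char3 g hg0 (coeff_g_sq g hg) Q ((hmem _).mp hX0) ((hmem _).mp hX1) ((hmem _).mp hX3)
          (fun h => hX2 ((hmem _).mpr h))
      · exact absurd ⟨hX1, hprime.mem_of_pow_mem 5 h2, hX3⟩ hnot
    · -- `∂₁ g = 3X1² + D ≡ D ∉ P`
      refine ClauseOfPderivNotMem.stub_clauseOfPderivNotMem 3 k 4 g Q 1 ?_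
      rw [hd1, show (C 3 : MvPolynomial (Fin 4) k) = 0 from by
        rw [show (3 : k) = 0 from CharP.cast_eq_zero k 3 ▸ by norm_cast, C_0], zero_mul, zero_add]
      exact hD
  · -- `∂₃ g = 2(X1 − 1)X3 ∉ P`
    have hX1m : (X 1 - 1 : MvPolynomial (Fin 4) k) ∉ Q.comap (Ideal.Quotient.mk (Ideal.span {g})) := fun h => by
      apply hprime.ne_top
      rw [Ideal.eq_top_iff_one]
      have e : (1 : MvPolynomial (Fin 4) k) = g - (X 1 - 1) * (X 1 ^ 2 + X 1 + 1 + (X 3 ^ 2 + X 0 ^ 2 * X 2 ^ 5)) := by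
        rw [hg]; ring
      rw [e]
      exact Ideal.sub_mem _ hgP (Ideal.mul_mem_right _ _ h)
    refine ClauseOfPderivNotMem.stub_clauseOfPderivNotMem 3 k 4 g Q 3 ?_
    rw [hd3]
    intro h
    have h' := E8OffCentreRegular.mem_of_C_mul_mem _ E7OffCentreRegular.two_ne_zero_of_charP_three h
    rcases hprime.mem_or_mem h' with h1 | h1
    · exact hX1m h1
    · exact hX3 h1

/-- **hoff₀ for the cone `g₀ = X1³ − X3² − X0²X2⁵`**: at every maximal ideal of `k[X]/(g₀)` missing one of `s̄, w̄̃, z̄̃` the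
per-stalk clause holds (`char k = 3`). [folklore] -/
theorem cuspE8LineCone_offStratum_clause [CharP k 3] (g₀ : MvPolynomial (Fin 4) k)
    (hg₀ : g₀ = X 1 ^ 3 - X 3 ^ 2 - X 0 ^ 2 * X 2 ^ 5) :
    ∀ (Q : Ideal (MvPolynomial (Fin 4) k ⧸ Ideal.span {g₀})) [Q.IsMaximal],
      (∃ j ∈ ({1, 2, 3} : Finset (Fin 4)), Ideal.Quotient.mk (Ideal.span {g₀}) (MvPolynomial.X j) ∉ Q) →
      ∀ d : ℕ, ringKrullDim (Localization.AtPrime Q) = d → ∀ s : Fin d → Localization.AtPrime Q,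
        (Ideal.span (Set.range s)).radical.IsMaximal →
          RingTheory.Sequence.IsWeaklyRegular (Localization.AtPrime Q) (List.ofFn s) ∧
          ∀ y : Localization.AtPrime Q, (∃ e : ℕ, y ^ 3 ^ e ∈ Ideal.span
            ((fun z : Localization.AtPrime Q => z ^ 3 ^ e) ''
              (Ideal.span (Set.range s) : Set (Localization.AtPrime Q)))) → y ∈ Ideal.span (Set.range s) := by
  intro Q _ hQ
  haveI : Fact (Nat.Prime 3) := ⟨Nat.prime_three⟩
  haveI hprime : (Q.comap (Ideal.Quotient.mk (Ideal.span {g₀}))).IsPrime := Ideal.comap_isPrime _ _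
  have hmem : ∀ q : MvPolynomial (Fin 4) k, q ∈ Q.comap (Ideal.Quotient.mk (Ideal.span {g₀})) ↔
      Ideal.Quotient.mk (Ideal.span {g₀}) q ∈ Q := fun q => Ideal.mem_comap
  have hgP : g₀ ∈ Q.comap (Ideal.Quotient.mk (Ideal.span {g₀})) := by
    rw [Ideal.mem_comap, Ideal.Quotient.eq_zero_iff_mem.mpr (Ideal.mem_span_singleton_self g₀)]; exact Q.zero_mem
  have hg0 : g₀ ≠ 0 := by
    rw [hg₀]; intro h
    have h1 := congrArg (MvPolynomial.eval (![0, 1, 0, 0] : Fin 4 → k)) h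
    simp at h1
  have hnot : ¬ ((X 1 : MvPolynomial (Fin 4) k) ∈ Q.comap (Ideal.Quotient.mk (Ideal.span {g₀})) ∧
      (X 2 : MvPolynomial (Fin 4) k) ∈ Q.comap (Ideal.Quotient.mk (Ideal.span {g₀})) ∧
      (X 3 : MvPolynomial (Fin 4) k) ∈ Q.comap (Ideal.Quotient.mk (Ideal.span {g₀}))) := by
    rintro ⟨h1, h2, h3⟩
    obtain ⟨j, hj, hjQ⟩ := hQ
    simp only [Finset.mem_insert, Finset.mem_singleton] at hj
    rcases hj with rfl | rfl | rfl
    exacts [hjQ ((hmem _).mp h1), hjQ ((hmem _).mp h2), hjQ ((hmem _).mp h3)]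
  obtain ⟨hd3, hd0⟩ := pderivs_g₀ k
  rw [← hg₀] at hd3 hd0
  have hm2 : ∀ x : MvPolynomial (Fin 4) k, C (-2 : k) * x ∈ Q.comap (Ideal.Quotient.mk (Ideal.span {g₀})) →
      x ∈ Q.comap (Ideal.Quotient.mk (Ideal.span {g₀})) := fun x hx => by
    have hu : IsUnit (C (-2 : k) : MvPolynomial (Fin 4) k) := (Ne.isUnit (neg_ne_zero.mpr E7OffCentreRegular.two_ne_zero_of_charP_three)).map C
    obtain ⟨u, hu'⟩ := hu
    rw [← hu'] at hx
    exact (Ideal.unit_mul_mem_iff_mem _ u.isUnit).mp hx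
  have hX1_of : (X 3 : MvPolynomial (Fin 4) k) ∈ Q.comap (Ideal.Quotient.mk (Ideal.span {g₀})) →
      (X 0 ^ 2 * X 2 ^ 5 : MvPolynomial (Fin 4) k) ∈ Q.comap (Ideal.Quotient.mk (Ideal.span {g₀})) →
      (X 1 : MvPolynomial (Fin 4) k) ∈ Q.comap (Ideal.Quotient.mk (Ideal.span {g₀})) := fun h3 h02 => by
    refine hprime.mem_of_pow_mem 3 ?_
    have e : (X 1 ^ 3 : MvPolynomial (Fin 4) k) = g₀ + X 3 * X 3 + X 0 ^ 2 * X 2 ^ 5 := by rw [hg₀]; ring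
    rw [e]
    exact Ideal.add_mem _ (Ideal.add_mem _ hgP (Ideal.mul_mem_left _ _ h3)) h02
  by_cases hX3 : (X 3 : MvPolynomial (Fin 4) k) ∈ Q.comap (Ideal.Quotient.mk (Ideal.span {g₀}))
  · by_cases h02 : (X 0 * X 2 ^ 5 : MvPolynomial (Fin 4) k) ∈ Q.comap (Ideal.Quotient.mk (Ideal.span {g₀}))
    · have h02' : (X 0 ^ 2 * X 2 ^ 5 : MvPolynomial (Fin 4) k) ∈ Q.comap (Ideal.Quotient.mk (Ideal.span {g₀})) := by
        rw [pow_two, mul_assoc]; exact Ideal.mul_mem_left _ _ h02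
      have hX1 := hX1_of hX3 h02'
      rcases hprime.mem_or_mem h02 with h0 | h2
      · have hX2 : (X 2 : MvPolynomial (Fin 4) k) ∉ Q.comap (Ideal.Quotient.mk (Ideal.span {g₀})) := fun h => hnot ⟨hX1, h, hX3⟩
        exact clause_on_line_char3 g₀ hg0 (hg₀ ▸ coeff_g₀_sq) Q ((hmem _).mp h0) ((hmem _).mp hX1) ((hmem _).mp hX3)
          (fun h => hX2 ((hmem _).mpr h))
      · exact absurd ⟨hX1, hprime.mem_of_pow_mem 5 h2, hX3⟩ hnot
    · refine ClauseOfPderivNotMem.stub_clauseOfPderivNotMem 3 k 4 g₀ Q 0 ?_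
      rw [hd0]
      exact fun h => h02 (hm2 _ h)
  · refine ClauseOfPderivNotMem.stub_clauseOfPderivNotMem 3 k 4 g₀ Q 3 ?_
    rw [hd3]
    exact fun h => hX3 (hm2 _ h)

end Summit.ResolutionOfSingularities.ResolutionOfSingularities.Theorems.FInjectiveMacaulayfication.CuspE8LineOffStratum

end
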